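import Summits.AtomisticToContinuum.Crystallization.Theorems.PalmUnimodularRigidityBenjaminiSchrammLimit
import Summits.AtomisticToContinuum.Crystallization.Theorems.ThreeConeCertificateSlackRigidityBSLimit

/-!
# Crux `TwelveWithinOne` (stmt-AtomisticToContinuum-15808, route `SquareWellLayerCake`), line `Sketch`:
# the Benjamini–Schramm limit of Lennard-Jones ground states along a prescribed subsequence

Stub `stub_bsLimitAlong` of the checked skeleton of line `Sketch`.  This is item
`stmt-AtomisticToContinuum-9230` (`BenjaminiSchrammLimit`, landed as
`BenjaminiSchrammLimit.exists_limit` / `benjaminiSchrammLimit_proof`, file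
`…Theorems.PalmUnimodularRigidityBenjaminiSchrammLimit`) with the local weak limit extracted ALONG AN
ARBITRARY PRESCRIBED strictly monotone `ψ : ℕ → ℕ` instead of along the full sequence: for every
sequence of Lennard-Jones ground states `x^N ⊂ ℝ³` and every such `ψ` there are a further subsequence
`ψ ∘ φ`, a hard core `δ > 0` and a probability law `P` on rooted `δ`-separated counting measures which is
point-stationary (Mecke / mass-transport identity), has mean root energy `lim_j E(ψ (φ j)) / ψ (φ j)`,
and receives the uniformly re-rooted `x^(ψ (φ j))` in the density-transfer (portmanteau) form.  The
crux `TwelveWithinOne` is a full `Tendsto` in `N`, whence the need for "every subsequence has a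
sub-subsequence".

Proof.  The hard core `δ = 1/3` is that of `LennardJonesMinimalDistance_holds`; the construction
along an arbitrary `δ`-separated family `k ↦ x (n k)` of nonempty configurations is the landed
`EkelandSurgeryParityBSLimit.exists_limit_separated` (file
`…Theorems.ThreeConeCertificateSlackRigidityBSLimit`, itself `BenjaminiSchrammLimit.exists_limit`
with `emp[n k, x k, _]` in place of `emp[N + 1, x (N + 1), _]`), applied to the family
`k ↦ x (ψ (k + 1))` (nonempty since `ψ (k + 1) ≥ k + 1`); the returned subsequence `φ'` gives
`φ j = φ' j + 1`, and `𝓔(x N) = E(N)` for ground states rewrites the energy clause.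
-/

noncomputable section

open MeasureTheory Filter Set
open scoped ENNReal Topology

namespace Summit.AtomisticToContinuum.Crystallization.Theorems.SquareWellLayerCakeTwelveWithinOne

open Literature.MathematicalPhysics.StatisticalMechanics
open Summit.AtomisticToContinuum.Crystallization.Theorems.EkelandSurgeryParityBSLimit
  (exists_limit_separated)

-- adapted from `benjaminiSchrammLimit_proof` (Theorems/PalmUnimodularRigidityBenjaminiSchrammLimit.lean)
-- and `EkelandSurgeryParityBSLimit.stub_bsLimit` (Theorems/ThreeConeCertificateSlackRigidityBSLimit.lean).
/-- **Stub `stub_bsLimitAlong` (line `Sketch` of crux `TwelveWithinOne`, stmt-AtomisticToContinuum-15808):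
the Benjamini–Schramm limit of Lennard-Jones ground states along a PRESCRIBED subsequence `ψ`.**
For every sequence of ground states `x^N ⊂ ℝ³` and every strictly monotone `ψ : ℕ → ℕ` there are a
further subsequence `ψ ∘ φ` (`φ` strictly monotone), a hard core `δ > 0` and a probability law `P` on
`Measure ℝ³` which is almost surely a rooted `δ`-separated counting measure, is point-stationary
(Mecke identity), has mean root energy `lim_j E(ψ (φ j)) / ψ (φ j)`, and to which the uniformly
re-rooted `x^(ψ (φ j))` converge in the density-transfer (portmanteau) form.  Item
`stmt-AtomisticToContinuum-9230` along `ψ`: `δ = 1/3` from `LennardJonesMinimalDistance_holds`, the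
limit from `exists_limit_separated` applied to the family `k ↦ x (ψ (k + 1))`. [folklore] -/
theorem stub_bsLimitAlong :
    ∀ x : (N : ℕ) → (Fin N → EuclideanSpace ℝ (Fin 3)), (∀ N, IsGroundState lennardJones (x N)) →
    ∀ ψ : ℕ → ℕ, StrictMono ψ →
    ∃ φ : ℕ → ℕ, StrictMono φ ∧ ∃ δ : ℝ, 0 < δ ∧
      ∃ P : Measure (Measure (EuclideanSpace ℝ (Fin 3))), IsProbabilityMeasure P ∧
      (∀ᵐ μ ∂P, (∃ S : Set (EuclideanSpace ℝ (Fin 3)), (0 : EuclideanSpace ℝ (Fin 3)) ∈ S ∧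
        (∀ x ∈ S, ∀ y ∈ S, x ≠ y → δ ≤ dist x y) ∧
        μ = (Measure.count : Measure (EuclideanSpace ℝ (Fin 3))).restrict S)) ∧
      (∀ g : Measure (EuclideanSpace ℝ (Fin 3)) → EuclideanSpace ℝ (Fin 3) → ℝ≥0∞,
        Measurable (Function.uncurry g) →
        ∫⁻ μ, ∫⁻ y, g μ y ∂μ ∂P = ∫⁻ μ, ∫⁻ y, g (Measure.map (fun z => z - y) μ) (-y) ∂μ ∂P) ∧
      Filter.Tendsto (fun j : ℕ => groundStateEnergy lennardJones 3 (ψ (φ j)) / (ψ (φ j) : ℝ))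
        Filter.atTop (nhds (∫ μ, (∫ y, lennardJones ‖y‖ ∂μ) / 2 ∂P)) ∧
      ∀ T : Set (Measure (EuclideanSpace ℝ (Fin 3))), ∀ R ε : ℝ, 0 < ε → ∀ ρ : ℝ, ρ < (P T).toReal →
        ∀ᶠ j : ℕ in Filter.atTop, ρ * (ψ (φ j) : ℝ) ≤ (Nat.card {i : Fin (ψ (φ j)) // ∃ ν ∈ T,
          ((∀ p : EuclideanSpace ℝ (Fin 3), ν {p} ≠ 0 → ‖p‖ ≤ R →
              ∃ q ∈ (Set.range (fun k : Fin (ψ (φ j)) => x (ψ (φ j)) k - x (ψ (φ j)) i)), dist q p ≤ ε) ∧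
            (∀ q ∈ (Set.range (fun k : Fin (ψ (φ j)) => x (ψ (φ j)) k - x (ψ (φ j)) i)), ‖q‖ ≤ R →
              ∃ p : EuclideanSpace ℝ (Fin 3), ν {p} ≠ 0 ∧ dist q p ≤ ε))} : ℝ) := by
  intro x hx ψ hψ
  -- the hard core of Lennard-Jones ground states
  obtain ⟨δ', hδ', hsepx⟩ := LennardJonesMinimalDistance_holds
  haveI : Fact (0 < δ') := ⟨hδ'⟩
  -- the family `k ↦ x (ψ (k + 1))` is nonempty (`ψ (k + 1) ≥ k + 1 ≥ 1`) and `δ'`-separated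
  haveI : ∀ k, NeZero (ψ (k + 1)) := fun k => ⟨((Nat.succ_pos k).trans_le hψ.le_apply).ne'⟩
  obtain ⟨φ, hφ, P, hP, hcore, hstat, hener, hdens⟩ :=
    exists_limit_separated (δ := δ') (n := fun k => ψ (k + 1)) (fun k => x (ψ (k + 1)))
      fun k i j hij => hsepx _ (x _) (hx _) i j hij
  refine ⟨fun j => φ j + 1, fun a b hab => Nat.succ_lt_succ (hφ hab), δ', hδ', P, hP, hcore, hstat,
    hener.congr fun j => ?_, hdens⟩
  -- `𝓔(x N) = E(N)` for ground states
  change interactionEnergy lennardJones (x (ψ (φ j + 1))) / (ψ (φ j + 1) : ℝ) =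
    groundStateEnergy lennardJones 3 (ψ (φ j + 1)) / (ψ (φ j + 1) : ℝ)
  rw [(hx _).2]

end Summit.AtomisticToContinuum.Crystallization.Theorems.SquareWellLayerCakeTwelveWithinOne
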